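import Literature.Topology.FourManifolds.HomotopySpheres
import Literature.Geometry.Symplectic.StandardEnd
import Literature.Geometry.Kaehler.ManifoldFormsChart
import Literature.Geometry.Kaehler.ManifoldFormsPullback
import Literature.Geometry.Kaehler.PullbackFamilyChart
import Literature.Analysis.FunctionSpaces.ParametricIntegralSmooth
import Mathlib.MeasureTheory.Integral.Bochner.ContinuousLinearMap
import Mathlib.Analysis.SpecialFunctions.SmoothTransition
import Mathlib.Analysis.Calculus.BumpFunction.FiniteDimension

/-!
# Helper `helper_croftonIntegrand` of stub `stub_croftonTaming` — line `crofton-pencil-laminar-charge`,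
crux `SullivanDual.Target` (stmt-SmoothPoincare4-7823), skeleton v2
(`Cruxes/Target/Lines/crofton_pencil_laminar_charge.lean`)

Setting: `Σ` a homotopy `4`-sphere, `p ∈ Σ`, `Σ ∖ p = punctured p` (an open submanifold, model
`𝓡 4`); a jointly smooth family `Φ : ℂ → (Σ ∖ p) → ℂ` (`(a, x) ↦ Φ a x` is `C^∞` on
`ℂ × (Σ ∖ p)`), a smooth `2`-form `β` on the vector space `ℂ × ℂ` vanishing at the points `q`
with `R ≤ ‖q.1‖` and whose exterior derivative vanishes on all triples of "vertical" vectors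
`(0, u), (0, v), (0, w)`. For the maps `Ψ_a : Σ ∖ p → ℂ × ℂ`, `Ψ_a x = (a, Φ a x)`, and the
pulled-back family `γ_a = Ψ_a^* β` the theorem records the four hypotheses consumed by the
parametric-integration engine of the line (`helper_integralForm`):

1. `γ_a = 0` for `R ≤ ‖a‖` (the form vanishes at the image point);
2. `(a, y) ↦ (γ_a)̂_{x₀}(y)` is jointly `C^∞` at every `(a, y)` with `y` in the target of the chart
   at `x₀` — the tree theorem `contDiffAt_inChart_pullback_family`
   (`Literature/Geometry/Kaehler/PullbackFamilyChart.lean`) for the jointly smooth family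
   `(a, x) ↦ (a, Φ a x)`;
3. each `γ_a` is closed: by naturality of `d` (tree `mextDeriv_pullback`,
   `Literature/NumberTheory/Transcendental/FormsAlgebra.lean`, discharged by the global instance
   `instPullbackFacts` of `ManifoldFormsPullback.lean`) `dγ_a = Ψ_a^*(dβ)`, and
   `dΨ_a v = (0, dΦ_a v)` is vertical, so `Ψ_a^*(dβ) = 0` by the hypothesis on `dβ`;
4. the evaluation formula `γ_a(x)(v, w) = β(a, Φ a x)((0, dΦ_a v), (0, dΦ_a w))`, again from
   `dΨ_a v = (0, dΦ_a v)` (product rule for `mfderiv` into the normed space `ℂ × ℂ`).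

## References

* F. W. Warner, *Foundations of Differentiable Manifolds and Lie Groups*, GTM 94 (1983),
  2.22–2.23 (pull-backs, naturality of `d`). [WarnerGTM94]
* J. M. Lee, *Introduction to Smooth Manifolds*, 2nd ed. (2013), Lemma 14.16. [LeeSmoothManifolds2013]
-/

noncomputable section

-- the prescribed namespace `Summit.<P>.<Sub>.…` duplicates `SmoothPoincare4` (P = Sub)
set_option linter.dupNamespace false

open scoped Manifold ContDiff Topology
open Set Filter MeasureTheory Literature.Geometry.Kaehler Literature.Geometry.Symplectic
  Literature.Topology.FourManifolds

namespace Summit.SmoothPoincare4.SmoothPoincare4.Theorems.Target.CroftonPencil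

section GraphSlice

variable {E' : Type*} [NormedAddCommGroup E'] [NormedSpace ℝ E']
  {H' : Type*} [TopologicalSpace H'] {I' : ModelWithCorners ℝ E' H'}
  {N : Type*} [TopologicalSpace N] [ChartedSpace H' N]
  {F₁ : Type*} [NormedAddCommGroup F₁] [NormedSpace ℝ F₁]
  {F₂ : Type*} [NormedAddCommGroup F₂] [NormedSpace ℝ F₂]

/-- **Differential of a horizontal slice of a graph.** For a map `f : N → F₂` into a normed space,
differentiable at `x`, and a constant `c : F₁`, the map `y ↦ (c, f y)` into the normed space
`F₁ × F₂` has differential `v ↦ (0, df_x v)` at `x` (product rule for `mfderiv`, the `𝓘(ℝ, F₁ × F₂)`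
version of Mathlib's `HasMFDerivAt.prodMk`, with `hasMFDerivAt_const`). [folklore] -/
theorem mfderiv_constProd_apply {f : N → F₂} {x : N} (hf : MDifferentiableAt I' 𝓘(ℝ, F₂) f x)
    (c : F₁) (v : TangentSpace I' x) :
    mfderiv I' 𝓘(ℝ, F₁ × F₂) (fun y => ((c, f y) : F₁ × F₂)) x v =
      ((0 : F₁), mfderiv I' 𝓘(ℝ, F₂) f x v) := by
  have hc := hasMFDerivAt_const (I := I') (I' := 𝓘(ℝ, F₁)) c x
  have hf' := hf.hasMFDerivAt
  have h : HasMFDerivAt I' 𝓘(ℝ, F₁ × F₂) (fun y => ((c, f y) : F₁ × F₂)) x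
      ((0 : TangentSpace I' x →L[ℝ] TangentSpace 𝓘(ℝ, F₁) c).prod (mfderiv I' 𝓘(ℝ, F₂) f x)) :=
    ⟨hc.1.prodMk hf'.1, hc.2.prodMk hf'.2⟩
  rw [h.mfderiv]
  rfl

end GraphSlice

/-- **Registered helper `helper_croftonIntegrand`** (signature registered verbatim on stmt-SmoothPoincare4-7823;
DO NOT change a token of the statement). For a jointly smooth family `Φ : ℂ → (Σ ∖ p) → ℂ`, a
smooth `2`-form `β` on `ℂ × ℂ` vanishing where `R ≤ ‖q.1‖` and with `dβ` vanishing on vertical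
triples, the pulled-back family `γ_a = Ψ_a^*β`, `Ψ_a x = (a, Φ a x)`, satisfies: `γ_a = 0` for
`R ≤ ‖a‖`; `(a, y) ↦ (γ_a)̂_{x₀}(y)` is jointly `C^∞` on the chart targets
(`contDiffAt_inChart_pullback_family`); each `γ_a` is closed (naturality `dΨ_a^*β = Ψ_a^* dβ`,
`mextDeriv_pullback`, and verticality of `dΨ_a = (0, dΦ_a)`); and
`γ_a(x)(v, w) = β(a, Φ a x)((0, dΦ_a v), (0, dΦ_a w))`. Warner (1983), 2.22–2.23.
[cite: WarnerGTM94, 2.22–2.23] -/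
theorem helper_croftonIntegrand :
    ∀ (S : HomotopySphere 4) (p : S.carrier) (Φ : ℂ → punctured p → ℂ)
      (β : MForm 𝓘(ℝ, ℂ × ℂ) (ℂ × ℂ) ℝ 2) (R : ℝ),
      ContMDiff (𝓘(ℝ, ℂ).prod (𝓡 4)) 𝓘(ℝ, ℂ) ∞ (Function.uncurry Φ) →
      IsSmoothForm β →
      (∀ q : ℂ × ℂ, R ≤ ‖q.1‖ → β q = 0) →
      (∀ (q : ℂ × ℂ) (u v w : ℂ), mextDeriv β q ![((0 : ℂ), u), ((0 : ℂ), v), ((0 : ℂ), w)] = 0) →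
      (∀ a : ℂ, R ≤ ‖a‖ → β.pullback (𝓡 4) (fun x : punctured p => (a, Φ a x)) = 0) ∧
      (∀ (x₀ : punctured p) (q : ℂ × EuclideanSpace ℝ (Fin 4)),
        q.2 ∈ (extChartAt (𝓡 4) x₀).target →
        ContDiffAt ℝ ∞ (fun q' : ℂ × EuclideanSpace ℝ (Fin 4) =>
          (β.pullback (𝓡 4) (fun x : punctured p => (q'.1, Φ q'.1 x))).inChart x₀ q'.2) q) ∧
      (∀ a : ℂ, IsClosedForm (β.pullback (𝓡 4) (fun x : punctured p => (a, Φ a x)))) ∧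
      (∀ (a : ℂ) (x : punctured p) (v w : TangentSpace (𝓡 4) x),
        β.pullback (𝓡 4) (fun x : punctured p => (a, Φ a x)) x ![v, w] =
          β (a, Φ a x) ![((0 : ℂ), mfderiv (𝓡 4) 𝓘(ℝ, ℂ) (Φ a) x v),
            ((0 : ℂ), mfderiv (𝓡 4) 𝓘(ℝ, ℂ) (Φ a) x w)]) := by
  intro S p Φ β R hΦ hβ h0 hd
  -- the slices `Φ a`, the maps `Ψ_a x = (a, Φ a x)` and the family `(a, x) ↦ Ψ_a x` are smooth
  have hΦa : ∀ a : ℂ, ContMDiff (𝓡 4) 𝓘(ℝ, ℂ) ∞ (Φ a) := fun a =>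
    hΦ.comp (contMDiff_const.prodMk contMDiff_id)
  have hΨ : ∀ a : ℂ,
      ContMDiff (𝓡 4) 𝓘(ℝ, ℂ × ℂ) ∞ (fun x : punctured p => ((a, Φ a x) : ℂ × ℂ)) := fun a =>
    contMDiff_const.prodMk_space (hΦa a)
  have huf : (Function.uncurry fun (a : ℂ) (x : punctured p) => ((a, Φ a x) : ℂ × ℂ)) =
      fun q => (q.1, Function.uncurry Φ q) := by
    funext ⟨a, x⟩
    rfl
  have hΨu : ContMDiff (𝓘(ℝ, ℂ).prod (𝓡 4)) 𝓘(ℝ, ℂ × ℂ) ∞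
      (Function.uncurry fun (a : ℂ) (x : punctured p) => ((a, Φ a x) : ℂ × ℂ)) := by
    rw [huf]
    exact contMDiff_fst.prodMk_space hΦ
  -- the differential of `Ψ_a` is vertical: `dΨ_a v = (0, dΦ_a v)`
  have hdΨ : ∀ (a : ℂ) (x : punctured p) (v : TangentSpace (𝓡 4) x),
      mfderiv (𝓡 4) 𝓘(ℝ, ℂ × ℂ) (fun x : punctured p => ((a, Φ a x) : ℂ × ℂ)) x v =
        ((0 : ℂ), mfderiv (𝓡 4) 𝓘(ℝ, ℂ) (Φ a) x v) := fun a x v =>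
    mfderiv_constProd_apply ((hΦa a).mdifferentiableAt (x := x) (by simp)) a v
  -- `dβ` vanishes on every vertical triple
  have hd' : ∀ (q : ℂ × ℂ) (g : Fin 3 → ℂ), mextDeriv β q (fun i => ((0 : ℂ), g i)) = 0 := by
    intro q g
    have hg : (fun i => ((0 : ℂ), g i)) = ![((0 : ℂ), g 0), ((0 : ℂ), g 1), ((0 : ℂ), g 2)] := by
      funext i
      fin_cases i <;> rfl
    rw [hg]
    exact hd q (g 0) (g 1) (g 2)
  refine ⟨?_, ?_, ?_, ?_⟩
  · -- (1) `γ_a = 0` for `R ≤ ‖a‖`: `β` vanishes at the image point `(a, Φ a x)`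
    intro a ha
    funext x
    ext m
    simp [MForm.pullback_apply, h0 (a, Φ a x) ha]
  · -- (2) joint smoothness of the chart representatives
    intro x₀ q hq
    exact contDiffAt_inChart_pullback_family (I := 𝓡 4) (I' := 𝓘(ℝ, ℂ × ℂ))
      (Ψ := fun (a : ℂ) (x : punctured p) => ((a, Φ a x) : ℂ × ℂ)) hβ hq
      (Eventually.of_forall fun q' => hΨu q')
  · -- (3) closedness: `dγ_a = Ψ_a^*(dβ)` and `dβ` vanishes on the vertical vectors `dΨ_a v`
    intro a
    unfold IsClosedForm
    rw [Literature.NumberTheory.Transcendental.mextDeriv_pullback (hΨ a) hβ]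
    funext x
    ext m
    rw [MForm.pullback_apply]
    simp only [hdΨ]
    exact hd' _ _
  · -- (4) the evaluation formula
    intro a x v w
    rw [MForm.pullback_apply]
    congr 1
    funext i
    rw [hdΨ]
    fin_cases i <;> rfl

end Summit.SmoothPoincare4.SmoothPoincare4.Theorems.Target.CroftonPencil

end
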